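import Mathlib
import HarnessLib
import Summits.ResolutionOfSingularities.ResolutionOfSingularities.Theorems.WildQuotientsWildQuotientResolutionBlowupExitBasicOpenSections
import Summits.ResolutionOfSingularities.ResolutionOfSingularities.Theorems.WildQuotientsWildQuotientResolutionPrincipalChartRees
import Summits.ResolutionOfSingularities.ResolutionOfSingularities.Theorems.WildQuotientsWildQuotientResolutionJordanFourChartWStable
import Summits.ResolutionOfSingularities.ResolutionOfSingularities.Theorems.WildQuotientsWildQuotientResolutionJordanFourPieceZeroBricks

/-!
# The seam instantiated for the two singular charts of `Bl_{I₆} 𝔸ⁿ` (`J₄`): `V[x_a²]` and `chartW`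
(crux stmt-ResolutionOfSingularities-15640 `WildQuotients.WildQuotientResolution`, line `Sketch`;
chain w45c programme V4U, CHAIN v7.7 — adapters of `BlowupExit.exists_basicOpen_sectionsEquiv`
(p510259) to the LITERAL binders of the ring bricks `H₀` / `H₁` of res-L1-w45c-lead-1's
`JordanFour.coneBrick_zero_of_ringBrick` / `coneBrick_T_of_ringBrick` (p508076); written by
res-D-pv-033 AS res-L1-w45c-stub-5 for res-type-087 (H₀) and res-type-036 (H₁); [OURS · L1 W4.5c] —
NOT a statement of any manuscript.)

* `JordanFour.exists_reesGradedHom_family_I6` — the coefficientwise Rees automorphisms `φ g`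
  (`g⁻¹` on coefficients) for `I₆`, with `φ g (x_a² t) = x_a² t`, `φ g (T′t·H′³t²) = T′t·H′³t²`;
* `JordanFour.exists_sectionsEquiv_chart0` — for `O₀.1 = V[x_a²]` (blowupChart form, as in `H₀`):
  `Ω₀ : (R[I₆t])_{(x_a² t)} ≃+* Γ(↥O₀.1, ⊤)` with (i) and (ii);
* `JordanFour.exists_sectionsEquiv_chartW` — for `O₁.1 = chartW` (as in `H₁`):
  `Ω_T : (R[I₆t])_{(T′t·H′³t²)} ≃+* Γ(↥O₁.1, ⊤)` with (i) and (ii).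
Then `BlowupExit.mem_invariantsRing_iff_of_sectionsEquiv` gives the invariants.
-/

-- single-problem summit: the doubled namespace component `ResolutionOfSingularities` is forced
set_option linter.dupNamespace false

noncomputable section

open CategoryTheory AlgebraicGeometry TopologicalSpace MvPolynomial Polynomial HomogeneousLocalization
open Literature.AlgebraicGeometry.Resolution Literature.AlgebraicGeometry.RelativeSpec
open scoped Pointwise

namespace Summit.ResolutionOfSingularities.ResolutionOfSingularities.Theorems.WildQuotientResolution.JordanFour

variable (k : Type) [Field k] (n : ℕ) (σ : MvPolynomial (Fin n) k ≃ₐ[k] MvPolynomial (Fin n) k)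
  (a b c d : Fin n) (hab : a ≠ b) (hac : a ≠ c) (had : a ≠ d)
  (hb : σ (X b) = X b + X a) (hc : σ (X c) = X c + X b) (hd : σ (X d) = X d + X c)
  (hσ : ∀ i, i ≠ b → i ≠ c → i ≠ d → σ (X i) = X i)

include hab hac had hb hc hd hσ in
/-- **The `φ`-family for `I₆`**: coefficientwise `g⁻¹` graded automorphisms of `k[x][I₆ t]`, with the
`Proj.map` hypothesis, fixing the two chart sections `x_a² t` and `T′t·H′³t²`. [OURS · L1 W4.5c]
[folklore; assembly of landed decls] -/
theorem exists_reesGradedHom_family_I6 :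
    ∃ φ : ↥(Subgroup.zpowers σ) →
        (reesGrading (Ideal.span (Set.range (![X a ^ 2, X a * X b ^ 2, X a * X b * X c, X a * X c ^ 3,
          X b ^ 3, X b ^ 2 * X c ^ 2, X b * X c ^ 4, X c ^ 6] : Fin 8 → MvPolynomial (Fin n) k))) →+*ᵍ
         reesGrading (Ideal.span (Set.range (![X a ^ 2, X a * X b ^ 2, X a * X b * X c, X a * X c ^ 3,
          X b ^ 3, X b ^ 2 * X c ^ 2, X b * X c ^ 4, X c ^ 6] : Fin 8 → MvPolynomial (Fin n) k)))),
      (∀ (g : ↥(Subgroup.zpowers σ)) x, ((φ g x : reesAlgebra _) : (MvPolynomial (Fin n) k)[X]) =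
        (x : (MvPolynomial (Fin n) k)[X]).map ((MulSemiringAction.toRingEquiv (↥(Subgroup.zpowers σ))
          (MvPolynomial (Fin n) k) g⁻¹ : _ ≃+* _) : _ →+* _)) ∧
      (∀ g, HomogeneousIdeal.irrelevant (reesGrading _) ≤
        (HomogeneousIdeal.irrelevant (reesGrading _)).map (φ g)) ∧
      (∀ (h0 : (X a ^ 2 : MvPolynomial (Fin n) k) ∈ Ideal.span (Set.range (![X a ^ 2, X a * X b ^ 2,
          X a * X b * X c, X a * X c ^ 3, X b ^ 3, X b ^ 2 * X c ^ 2, X b * X c ^ 4, X c ^ 6] :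
            Fin 8 → MvPolynomial (Fin n) k))) g,
        φ g (reesT (X a ^ 2 : MvPolynomial (Fin n) k) h0) = reesT (X a ^ 2 : MvPolynomial (Fin n) k) h0) ∧
      (∀ g, φ g (reesT (tPrime k n a b c d) (tPrime_mem_I6 k n a b c d) * hCubeT2 k n a b c) =
        reesT (tPrime k n a b c d) (tPrime_mem_I6 k n a b c d) * hCubeT2 k n a b c) := by
  obtain ⟨φ, hφ, hf⟩ := BlowupExit.exists_reesGradedHom_family
    (I := Ideal.span (Set.range (![X a ^ 2, X a * X b ^ 2, X a * X b * X c, X a * X c ^ 3,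
      X b ^ 3, X b ^ 2 * X c ^ 2, X b * X c ^ 4, X c ^ 6] : Fin 8 → MvPolynomial (Fin n) k)))
    (smul_I6_eq k n σ a b c (hσ a hab hac had) hb hc)
  refine ⟨φ, hφ, hf, fun h0 g => ?_, fun g => ?_⟩
  · refine BlowupExit.reesGradedHom_eq_self_of_monomial _ (X a ^ 2) (coe_reesT _ _) (φ g) _ (hφ g) ?_
    change (MulSemiringAction.toRingEquiv _ _ g⁻¹) (X a ^ 2) = X a ^ 2
    rw [MulSemiringAction.toRingEquiv_apply_apply, smul_pow']
    -- `g⁻¹ • x_a = x_a`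
    have hfix : (g⁻¹ : ↥(Subgroup.zpowers σ)) • (X a : MvPolynomial (Fin n) k) = X a := by
      have hσ' : σ • (X a : MvPolynomial (Fin n) k) = X a := hσ a hab hac had
      obtain ⟨z, hz⟩ := Subgroup.mem_zpowers_iff.mp (g⁻¹).2
      change ((g⁻¹ : ↥(Subgroup.zpowers σ)) : MvPolynomial (Fin n) k ≃ₐ[k] MvPolynomial (Fin n) k) •
        (X a : MvPolynomial (Fin n) k) = X a
      rw [← hz]
      exact MulAction.fixedBy_subset_fixedBy_zpow (MvPolynomial (Fin n) k) σ z hσ'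
    rw [hfix]
  · refine BlowupExit.reesGradedHom_eq_self_of_monomial _ (tPrime k n a b c d * hPrime k n a b c ^ 3)
      (coe_chartW_section k n a b c d) (φ g) _ (hφ g) ?_
    change (MulSemiringAction.toRingEquiv _ _ g⁻¹) _ = _
    rw [MulSemiringAction.toRingEquiv_apply_apply]
    exact smul_tPrime_mul_hPrime_cube k n σ a b c d hab hac had hb hc hd hσ g⁻¹

end Summit.ResolutionOfSingularities.ResolutionOfSingularities.Theorems.WildQuotientResolution.JordanFour

end
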